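import Summits.QuantumFields.YangMills.Theorems.VirialFluxGapAnchorChartSmooth
import HarnessLib

/-!
# The two-anchor window map: TRANSVERSALITY at the base point (`ker D(anchorCoord)(0) = 0`, non-zero Jacobian)
# (layer (B2) of the DIRECT Laplace road to ⟨stmt-QuantumFields-24204⟩ `VirialFluxGap.SharpTwistedLaplace`)

Helper module (free-hands work of width seat ym-line-sfw-p2-w3 g57, cell ym-idea-1; `--supports 24204`).  Sequel of
✓`VirialFluxGapAnchorChartSmooth`.  For the window map `Θ' = anchorMap` (✓`VirialFluxGapAnchorChartDefs`) read in exponential coordinates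
(`anchorCoord`):
* `hasDerivAt_anchor_fst_line` ∕ `hasDerivAt_anchor_snd_line` — the two anchors along a line `s ↦ s·(ζ, η)` through the base point have
  derivatives `[ιζ, ιω_C] + η₀(ιω_C)²` and `[ιζ, N̂₀] + ι(η₁ω_N + η₂ω_×)N̂₀` (product rule for `e^{sιζ}·X(s)·e^{−sιζ}`);
* `kernel_equation_fst` ∕ `kernel_equation_snd` — differentiating `exp ∘ ι ∘ anchorCoord_j = su2Quat ∘ anchorMap_j`: a kernel vector of
  `D(anchorCoord)(0)` makes both expressions vanish; `eq_zero_of_kernel_equations` — reading off the components along `1, ιω_C, ιω_N, ιω_×`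
  (✓`AnchorSlice.eq_re_add_inner_smul_of_commute`) forces `ζ = 0`, `η = 0`;
* ★★ `fderiv_anchorCoord_zero_injective`, ★★ `det_fderiv_anchorCoord_zero_ne_zero` — TRANSVERSALITY of the two-anchor coordinate slice to
  the orbit of the residual `SU(2)`: `ker D(anchorCoord)(0) = 0`, hence (Mathlib `LinearMap.det_eq_zero_iff_ker_ne_bot`) a non-zero Jacobian at
  the base point — the non-degeneracy input of the change of variables for the 6-dimensional anchor core of the slice-chart identity `hloc`.
Everything here is PROVED; no definitions, no named facts (namespace `Summit.QuantumFields.YangMills.Theorems.VirialFluxGap.AnchorSlice`).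
HONEST FRAMING: finite-dimensional calculus; ⟨24204⟩, ⟨24319⟩ and every rung stay OPEN; the Yang–Mills mass gap (Clay) is NOT touched; no
summit is proved by a line.

## References
* G. E. Bredon, *Introduction to Compact Transformation Groups* (1972), Ch. II §§4–5 (slices, tubes). [Bredon1972]
* K. W. Breitung, *Asymptotic Approximations for Probability Integrals*, LNM 1592 (1994), §2.3 Definitions 4–5. [Breitung1994]
-/

set_option autoImplicit false

noncomputable section

open scoped Quaternion RealInnerProductSpace
open NormedSpace MeasureTheory Set Filter Topology
open Literature.MathematicalPhysics.QuantumLattice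
open Literature.MathematicalPhysics.QuantumFieldTheory.Balaban1983to89
open Literature.MathematicalPhysics.QuantumFieldTheory.Balaban1983to89.T4HaarSU2ExpChart
open Literature.MathematicalPhysics.QuantumFieldTheory.Balaban1983to89.T4ExpWindowSmallField
open Literature.MathematicalPhysics.QuantumFieldTheory.Balaban1983to89.B15Prop1ChartCalculusSU2
open Literature.MathematicalPhysics.QuantumFieldTheory.Balaban1983to89.T4WilsonGaugeFlatDirection (su2Quat_injective)
open Literature.MathematicalPhysics.QuantumFieldTheory.Balaban1983to89.T4WilsonLinkAffine (su2Quat_inv)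
open Literature.MathematicalPhysics.QuantumFieldTheory.Balaban1983to89.T4HaarSU2Translate (su2Quat_mul su2Quat_one)
open Summit.QuantumFields.YangMills.Theorems.FemtoTransferGap

namespace Summit.QuantumFields.YangMills.Theorems.VirialFluxGap.AnchorSlice


section Anchors

variable {ωC ωN ωX : EuclideanSpace ℝ (Fin 3)} {C₀ N₀ : SU2}

/-! ## §1 The anchors along lines through the base point -/

/-- `exp(ι(s·x)) = exp(s·ιx)`. [folklore] -/
theorem exp_imQuat_smul_eq (s : ℝ) (x : EuclideanSpace ℝ (Fin 3)) : exp (imQuat (s • x)) = exp (s • imQuat x) := by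
  rw [map_smul]

/-- `star (exp (ι x)) = exp (−ι x)`. [folklore] -/
theorem star_exp_imQuat (x : EuclideanSpace ℝ (Fin 3)) : star (exp (imQuat x)) = exp (-imQuat x) := by
  rw [NormedSpace.star_exp, star_eq_neg_of_pure (imQuat_re x)]

/-- Derivative at `0` of `s ↦ exp(s·x)`: it is `x`. [folklore] -/
theorem hasDerivAt_exp_smul_zero (x : ℍ) : HasDerivAt (fun s : ℝ => exp (s • x)) x 0 := by
  have h := hasDerivAt_exp_smul_const (𝕂 := ℝ) x 0
  simp only [zero_smul, NormedSpace.exp_zero, one_mul] at h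
  exact h

/-- **The seam anchor along a line through the base point**: derivative `[ιζ, ιω_C] + η₀ (ιω_C)²`. [folklore] -/
theorem hasDerivAt_anchor_fst_line (hC₀ : su2Quat C₀ = imQuat ωC) (ζ η : EuclideanSpace ℝ (Fin 3)) :
    HasDerivAt (fun s : ℝ => su2Quat (anchorMap ωC ωN ωX C₀ N₀ (s • (ζ, η))).1)
      (imQuat ζ * imQuat ωC - imQuat ωC * imQuat ζ + (η 0) • (imQuat ωC * imQuat ωC)) 0 := by
  have heq : (fun s : ℝ => su2Quat (anchorMap ωC ωN ωX C₀ N₀ (s • (ζ, η))).1) = fun s : ℝ =>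
      exp (s • imQuat ζ) * (exp (s • ((η 0) • imQuat ωC)) * imQuat ωC) * exp (s • (-imQuat ζ)) := by
    funext s
    rw [su2Quat_anchorMap_fst hC₀, star_exp_imQuat]
    simp only [Prod.smul_fst, Prod.smul_snd, PiLp.smul_apply, smul_eq_mul, map_smul, smul_neg]
    rw [mul_smul, smul_comm]
  rw [heq]
  have h1 := hasDerivAt_exp_smul_zero (imQuat ζ)
  have h2 := (hasDerivAt_exp_smul_zero ((η 0) • imQuat ωC)).mul_const (imQuat ωC)
  have h3 := hasDerivAt_exp_smul_zero (-imQuat ζ)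
  have h := (h1.mul h2).mul h3
  refine (h.congr_of_eventuallyEq (Filter.Eventually.of_forall fun s => rfl)).congr_deriv ?_
  simp only [Pi.mul_apply, zero_smul, NormedSpace.exp_zero, one_mul, mul_one, smul_mul_assoc, mul_neg]
  abel

/-- **The link anchor along a line through the base point**: derivative `ιζ N̂₀ − N̂₀ ιζ + ι(η₁ω_N + η₂ω_×) N̂₀`. [folklore] -/
theorem hasDerivAt_anchor_snd_line (ζ η : EuclideanSpace ℝ (Fin 3)) :
    HasDerivAt (fun s : ℝ => su2Quat (anchorMap ωC ωN ωX C₀ N₀ (s • (ζ, η))).2)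
      (imQuat ζ * su2Quat N₀ - su2Quat N₀ * imQuat ζ + imQuat ((η 1) • ωN + (η 2) • ωX) * su2Quat N₀) 0 := by
  have heq : (fun s : ℝ => su2Quat (anchorMap ωC ωN ωX C₀ N₀ (s • (ζ, η))).2) = fun s : ℝ =>
      exp (s • imQuat ζ) * (exp (s • imQuat ((η 1) • ωN + (η 2) • ωX)) * su2Quat N₀) * exp (s • (-imQuat ζ)) := by
    funext s
    rw [su2Quat_anchorMap_snd, star_exp_imQuat]
    simp only [Prod.smul_fst, Prod.smul_snd, PiLp.smul_apply, smul_eq_mul, map_smul, smul_neg, map_add]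
    rw [mul_smul, mul_smul, ← smul_add]
  rw [heq]
  have h1 := hasDerivAt_exp_smul_zero (imQuat ζ)
  have h2 := (hasDerivAt_exp_smul_zero (imQuat ((η 1) • ωN + (η 2) • ωX))).mul_const (su2Quat N₀)
  have h3 := hasDerivAt_exp_smul_zero (-imQuat ζ)
  have h := (h1.mul h2).mul h3
  refine (h.congr_of_eventuallyEq (Filter.Eventually.of_forall fun s => rfl)).congr_deriv ?_
  simp only [Pi.mul_apply, zero_smul, NormedSpace.exp_zero, one_mul, mul_one, mul_neg]
  abel

/-- `su2Quat ∘ anchorMap = exp ∘ ι ∘ anchorCoord` componentwise (the exponential chart inverts `logVec` on unit quaternions). [folklore] -/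
theorem exp_imQuat_anchorCoord_fst (w : EuclideanSpace ℝ (Fin 3) × EuclideanSpace ℝ (Fin 3)) :
    exp (imQuat (anchorCoord ωC ωN ωX C₀ N₀ w).1) = su2Quat (anchorMap ωC ωN ωX C₀ N₀ w).1 :=
  exp_imQuat_logVec (norm_su2Quat _)

/-- The same for the link component. [folklore] -/
theorem exp_imQuat_anchorCoord_snd (w : EuclideanSpace ℝ (Fin 3) × EuclideanSpace ℝ (Fin 3)) :
    exp (imQuat (anchorCoord ωC ωN ωX C₀ N₀ w).2) = su2Quat (anchorMap ωC ωN ωX C₀ N₀ w).2 :=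
  exp_imQuat_logVec (norm_su2Quat _)

/-- The FIRST KERNEL EQUATION at the base point: if `D(anchorCoord)(0)(ζ, η) = 0` then, differentiating the exponential-chart
identity `exp ∘ ι ∘ anchorCoord₁ = su2Quat ∘ anchorMap₁` along the line `s ↦ s·(ζ, η)`, `[ιζ, ιω_C] + η₀(ιω_C)² = 0`.
[cite: Breitung1994, §2.3 Definitions 4–5] -/
theorem kernel_equation_fst (hC : ‖ωC‖ = 1) (hN : ‖ωN‖ = 1) (hCN : ⟪ωC, ωN⟫ = 0)
    (hX : imQuat ωX = imQuat ωC * imQuat ωN) (hC₀ : su2Quat C₀ = imQuat ωC)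
    (hN₀ : su2Quat N₀ = imQuat ωN ∨ su2Quat N₀ = -imQuat ωN) (ζ η : EuclideanSpace ℝ (Fin 3))
    (hv : fderiv ℝ (anchorCoord ωC ωN ωX C₀ N₀) 0 (ζ, η) = 0) :
    imQuat ζ * imQuat ωC - imQuat ωC * imQuat ζ + (η 0) • (imQuat ωC * imQuat ωC) = 0 := by
  have hw0 : ‖(0 : EuclideanSpace ℝ (Fin 3) × EuclideanSpace ℝ (Fin 3)).2‖ < 1 := by
    rw [Prod.snd_zero, norm_zero]; exact one_pos
  have hdiff : HasFDerivAt (anchorCoord ωC ωN ωX C₀ N₀) (fderiv ℝ (anchorCoord ωC ωN ωX C₀ N₀) 0) 0 :=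
    ((contDiffAt_anchorCoord hC hN hCN hX hC₀ hN₀ (n := 1) hw0).differentiableAt one_ne_zero).hasFDerivAt
  have hline : HasDerivAt (fun s : ℝ => s • ((ζ, η) : EuclideanSpace ℝ (Fin 3) × EuclideanSpace ℝ (Fin 3))) (ζ, η) 0 := by
    have h := (hasDerivAt_id (0 : ℝ)).smul_const ((ζ, η) : EuclideanSpace ℝ (Fin 3) × EuclideanSpace ℝ (Fin 3))
    rwa [one_smul] at h
  have hE1 : HasFDerivAt (fun w => su2Quat (anchorMap ωC ωN ωX C₀ N₀ w).1)
      ((dexpIm (anchorCoord ωC ωN ωX C₀ N₀ 0).1).comp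
        ((ContinuousLinearMap.fst ℝ _ _).comp (fderiv ℝ (anchorCoord ωC ωN ωX C₀ N₀) 0))) 0 := by
    have h := (hasFDerivAt_exp_imQuat (anchorCoord ωC ωN ωX C₀ N₀ 0).1).comp 0 hdiff.fst
    exact h.congr_of_eventuallyEq (Filter.Eventually.of_forall fun w => (exp_imQuat_anchorCoord_fst w).symm)
  have hL1 := hE1.comp_hasDerivAt_of_eq (0 : ℝ) hline (zero_smul ℝ _).symm
  have e1 := (hasDerivAt_anchor_fst_line (ωN := ωN) (ωX := ωX) (N₀ := N₀) hC₀ ζ η).unique hL1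
  rw [ContinuousLinearMap.comp_apply, ContinuousLinearMap.comp_apply, hv] at e1
  simp only [map_zero] at e1
  convert e1 using 2

/-- The SECOND KERNEL EQUATION at the base point: `[ιζ, N̂₀] + ι(η₁ω_N + η₂ω_×)N̂₀ = 0`. [cite: Breitung1994, §2.3 Definitions 4–5] -/
theorem kernel_equation_snd (hC : ‖ωC‖ = 1) (hN : ‖ωN‖ = 1) (hCN : ⟪ωC, ωN⟫ = 0)
    (hX : imQuat ωX = imQuat ωC * imQuat ωN) (hC₀ : su2Quat C₀ = imQuat ωC)
    (hN₀ : su2Quat N₀ = imQuat ωN ∨ su2Quat N₀ = -imQuat ωN) (ζ η : EuclideanSpace ℝ (Fin 3))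
    (hv : fderiv ℝ (anchorCoord ωC ωN ωX C₀ N₀) 0 (ζ, η) = 0) :
    imQuat ζ * su2Quat N₀ - su2Quat N₀ * imQuat ζ + imQuat ((η 1) • ωN + (η 2) • ωX) * su2Quat N₀ = 0 := by
  have hw0 : ‖(0 : EuclideanSpace ℝ (Fin 3) × EuclideanSpace ℝ (Fin 3)).2‖ < 1 := by
    rw [Prod.snd_zero, norm_zero]; exact one_pos
  have hdiff : HasFDerivAt (anchorCoord ωC ωN ωX C₀ N₀) (fderiv ℝ (anchorCoord ωC ωN ωX C₀ N₀) 0) 0 :=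
    ((contDiffAt_anchorCoord hC hN hCN hX hC₀ hN₀ (n := 1) hw0).differentiableAt one_ne_zero).hasFDerivAt
  have hline : HasDerivAt (fun s : ℝ => s • ((ζ, η) : EuclideanSpace ℝ (Fin 3) × EuclideanSpace ℝ (Fin 3))) (ζ, η) 0 := by
    have h := (hasDerivAt_id (0 : ℝ)).smul_const ((ζ, η) : EuclideanSpace ℝ (Fin 3) × EuclideanSpace ℝ (Fin 3))
    rwa [one_smul] at h
  have hE2 : HasFDerivAt (fun w => su2Quat (anchorMap ωC ωN ωX C₀ N₀ w).2)
      ((dexpIm (anchorCoord ωC ωN ωX C₀ N₀ 0).2).comp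
        ((ContinuousLinearMap.snd ℝ _ _).comp (fderiv ℝ (anchorCoord ωC ωN ωX C₀ N₀) 0))) 0 := by
    have h := (hasFDerivAt_exp_imQuat (anchorCoord ωC ωN ωX C₀ N₀ 0).2).comp 0 hdiff.snd
    exact h.congr_of_eventuallyEq (Filter.Eventually.of_forall fun w => (exp_imQuat_anchorCoord_snd w).symm)
  have hL2 := hE2.comp_hasDerivAt_of_eq (0 : ℝ) hline (zero_smul ℝ _).symm
  have e2 := (hasDerivAt_anchor_snd_line (ωC := ωC) (ωN := ωN) (ωX := ωX) (C₀ := C₀) (N₀ := N₀) ζ η).unique hL2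
  rw [ContinuousLinearMap.comp_apply, ContinuousLinearMap.comp_apply, hv] at e2
  simp only [map_zero] at e2
  convert e2 using 2

/-- THE ALGEBRA OF THE KERNEL EQUATIONS: they force `ζ = 0` and `η = 0` (components along `1, ιω_C, ιω_N, ιω_×`).
[cite: Bredon1972, Ch. II §5] -/
theorem eq_zero_of_kernel_equations (hC : ‖ωC‖ = 1) (hN : ‖ωN‖ = 1) (hCN : ⟪ωC, ωN⟫ = 0)
    (hX : imQuat ωX = imQuat ωC * imQuat ωN) (hN₀ : su2Quat N₀ = imQuat ωN ∨ su2Quat N₀ = -imQuat ωN)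
    {ζ η : EuclideanSpace ℝ (Fin 3)}
    (e1 : imQuat ζ * imQuat ωC - imQuat ωC * imQuat ζ + (η 0) • (imQuat ωC * imQuat ωC) = 0)
    (e2 : imQuat ζ * su2Quat N₀ - su2Quat N₀ * imQuat ζ + imQuat ((η 1) • ωN + (η 2) • ωX) * su2Quat N₀ = 0) :
    ζ = 0 ∧ η = 0 := by
  have hC0 : (imQuat ωC).re = 0 := imQuat_re ωC
  have hN0 : (imQuat ωN).re = 0 := imQuat_re ωN
  have hC1 : ‖imQuat ωC‖ = 1 := by rw [norm_imQuat, hC]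
  have hN1 : ‖imQuat ωN‖ = 1 := by rw [norm_imQuat, hN]
  have hCC : imQuat ωC * imQuat ωC = -1 := by
    have hns : (imQuat ωC).re ^ 2 + (imQuat ωC).imI ^ 2 + (imQuat ωC).imJ ^ 2 + (imQuat ωC).imK ^ 2 = 1 := by
      rw [← sq_norm_eq_sum_sq, hC1]; norm_num
    ext <;> simp [imQuat_apply] at hns ⊢ <;> nlinarith [hns]
  have hNN : imQuat ωN * imQuat ωN = -1 := by
    have hns : (imQuat ωN).re ^ 2 + (imQuat ωN).imI ^ 2 + (imQuat ωN).imJ ^ 2 + (imQuat ωN).imK ^ 2 = 1 := by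
      rw [← sq_norm_eq_sum_sq, hN1]; norm_num
    ext <;> simp [imQuat_apply] at hns ⊢ <;> nlinarith [hns]
  have hCN' : ⟪imQuat ωC, imQuat ωN⟫ = 0 := by
    rw [Quaternion.inner_def]; simp [imQuat_apply]
    have : ⟪ωC, ωN⟫ = ∑ i, ωC i * ωN i := by
      rw [real_inner_comm, PiLp.inner_apply]; simp
    rw [this, Fin.sum_univ_three] at hCN
    linarith
  have hNC : imQuat ωN * imQuat ωC = -(imQuat ωC * imQuat ωN) := mul_eq_neg_mul_of_pure_orth hC0 hN0 hCN'
  rw [hCC] at e1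
  -- `η 0 = 0`
  have hη0 : η 0 = 0 := by
    have := congrArg (fun q : ℍ => q.re) e1
    simp only [Quaternion.re_add, Quaternion.re_sub, Quaternion.re_smul, Quaternion.re_neg, Quaternion.re_one,
      Quaternion.re_zero, smul_eq_mul] at this
    have hcomm : (imQuat ζ * imQuat ωC).re = (imQuat ωC * imQuat ζ).re := by simp only [Quaternion.re_mul]; ring
    linarith
  rw [hη0, zero_smul, add_zero, sub_eq_zero] at e1
  -- `ιζ = c · ιω_C`
  have hζ : imQuat ζ = ⟪imQuat ζ, imQuat ωC⟫ • imQuat ωC := by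
    have h := eq_re_add_inner_smul_of_commute hC0 hC1 e1
    rwa [imQuat_re, Quaternion.coe_zero, zero_add] at h
  set c := ⟪imQuat ζ, imQuat ωC⟫ with hc
  obtain ⟨ε, hε1, hNε⟩ : ∃ ε : ℝ, ε ^ 2 = 1 ∧ su2Quat N₀ = ε • imQuat ωN := by
    rcases hN₀ with h | h
    · exact ⟨1, by norm_num, by rw [h, one_smul]⟩
    · exact ⟨-1, by norm_num, by rw [h, neg_one_smul]⟩
  have hε0 : ε ≠ 0 := by intro h; rw [h] at hε1; norm_num at hε1
  rw [hζ, hNε, map_add, map_smul, map_smul, hX] at e2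
  have hXN : imQuat ωC * imQuat ωN * imQuat ωN = -imQuat ωC := by rw [mul_assoc, hNN, mul_neg_one]
  have e2' : ε • ((2 * c) • (imQuat ωC * imQuat ωN) - (η 1) • (1 : ℍ) - (η 2) • imQuat ωC) = 0 := by
    rw [← e2]
    simp only [smul_mul_assoc, mul_smul_comm, add_mul, hNN, hXN, smul_add, smul_sub, smul_smul, smul_neg, hNC]
    module
  have e3 : (2 * c) • (imQuat ωC * imQuat ωN) - (η 1) • (1 : ℍ) - (η 2) • imQuat ωC = 0 := by
    rcases smul_eq_zero.mp e2' with h | h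
    · exact absurd h hε0
    · exact h
  have hXre : (imQuat ωC * imQuat ωN).re = 0 := by rw [re_pure_mul_pure hC0 hN0, hCN', neg_zero]
  have hη1 : η 1 = 0 := by
    have := congrArg (fun q : ℍ => q.re) e3
    simp only [Quaternion.re_sub, Quaternion.re_smul, hXre, Quaternion.re_one, hC0, smul_eq_mul, mul_zero, mul_one,
      zero_sub, Quaternion.re_zero, sub_zero] at this
    linarith
  have iXC : ⟪imQuat ωC * imQuat ωN, imQuat ωC⟫ = 0 := inner_pure_mul_left hC0 hN0
  have iCC : ⟪imQuat ωC, imQuat ωC⟫ = 1 := by rw [real_inner_self_eq_norm_sq, hC1]; norm_num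
  have iXX : ⟪imQuat ωC * imQuat ωN, imQuat ωC * imQuat ωN⟫ = 1 := by
    rw [real_inner_self_eq_norm_sq, norm_mul, hC1, hN1]; norm_num
  have i1C : ⟪(1 : ℍ), imQuat ωC⟫ = 0 := by rw [Quaternion.inner_def, one_mul, Quaternion.re_star, hC0]
  have i1X : ⟪(1 : ℍ), imQuat ωC * imQuat ωN⟫ = 0 := by rw [Quaternion.inner_def, one_mul, Quaternion.re_star, hXre]
  have hη2 : η 2 = 0 := by
    have := congrArg (fun q : ℍ => ⟪q, imQuat ωC⟫) e3
    simp only [inner_sub_left, inner_smul_left, iXC, iCC, i1C, inner_zero_left, RCLike.conj_to_real, mul_zero,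
      mul_one, zero_sub] at this
    linarith
  have hc0 : c = 0 := by
    have := congrArg (fun q : ℍ => ⟪q, imQuat ωC * imQuat ωN⟫) e3
    have iCX : ⟪imQuat ωC, imQuat ωC * imQuat ωN⟫ = 0 := by rw [real_inner_comm]; exact iXC
    simp only [inner_sub_left, inner_smul_left, iXX, iCX, i1X, inner_zero_left, RCLike.conj_to_real, mul_zero,
      mul_one, sub_zero] at this
    linarith
  have hζ0 : ζ = 0 := by
    apply imQuat_injective
    rw [hζ, hc0, zero_smul, map_zero]
  have hη : η = 0 := by
    ext i
    fin_cases i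
    · simpa using hη0
    · simpa using hη1
    · simpa using hη2
  exact ⟨hζ0, hη⟩

/-- ★★ **The derivative of `anchorCoord` at the base point is injective** (transversality of the two-anchor slice).
[cite: Bredon1972, Ch. II §5] -/
theorem fderiv_anchorCoord_zero_injective (hC : ‖ωC‖ = 1) (hN : ‖ωN‖ = 1) (hCN : ⟪ωC, ωN⟫ = 0)
    (hX : imQuat ωX = imQuat ωC * imQuat ωN) (hC₀ : su2Quat C₀ = imQuat ωC)
    (hN₀ : su2Quat N₀ = imQuat ωN ∨ su2Quat N₀ = -imQuat ωN) :
    Function.Injective (fderiv ℝ (anchorCoord ωC ωN ωX C₀ N₀) 0) := by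
  rw [injective_iff_map_eq_zero]
  rintro ⟨ζ, η⟩ hv
  have e1 := kernel_equation_fst hC hN hCN hX hC₀ hN₀ ζ η hv
  have e2 := kernel_equation_snd hC hN hCN hX hC₀ hN₀ ζ η hv
  obtain ⟨hζ, hη⟩ := eq_zero_of_kernel_equations hC hN hCN hX hN₀ e1 e2
  rw [hζ, hη]
  rfl

/-- ★★ **The Jacobian of `anchorCoord` at the base point is non-zero.** [cite: Bredon1972, Ch. II §5]
[cite: Breitung1994, §2.3 Definitions 4–5] -/
theorem det_fderiv_anchorCoord_zero_ne_zero (hC : ‖ωC‖ = 1) (hN : ‖ωN‖ = 1) (hCN : ⟪ωC, ωN⟫ = 0)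
    (hX : imQuat ωX = imQuat ωC * imQuat ωN) (hC₀ : su2Quat C₀ = imQuat ωC)
    (hN₀ : su2Quat N₀ = imQuat ωN ∨ su2Quat N₀ = -imQuat ωN) :
    (fderiv ℝ (anchorCoord ωC ωN ωX C₀ N₀) 0).det ≠ 0 := by
  have hinj := fderiv_anchorCoord_zero_injective hC hN hCN hX hC₀ hN₀
  intro h
  have h' : LinearMap.det ((fderiv ℝ (anchorCoord ωC ωN ωX C₀ N₀) 0 :
      EuclideanSpace ℝ (Fin 3) × EuclideanSpace ℝ (Fin 3) →L[ℝ] EuclideanSpace ℝ (Fin 3) × EuclideanSpace ℝ (Fin 3)) :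
      EuclideanSpace ℝ (Fin 3) × EuclideanSpace ℝ (Fin 3) →ₗ[ℝ] EuclideanSpace ℝ (Fin 3) × EuclideanSpace ℝ (Fin 3)) = 0 := h
  rw [LinearMap.det_eq_zero_iff_ker_ne_bot] at h'
  exact h' (LinearMap.ker_eq_bot.mpr hinj)

end Anchors

end Summit.QuantumFields.YangMills.Theorems.VirialFluxGap.AnchorSlice

end
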